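import Mathlib.Topology.Algebra.ClopenNhdofOne
import Mathlib.Topology.Algebra.Ring.Real
import Literature.AnabelianGeometry.SemiGraphs.TemperedAnabelianWitness
import Literature.AnabelianGeometry.SemiGraphs.ProfiniteCompletionEta

/-!
# FACT-LIST row F-2551 `IsProfiniteCompletion` [structure] — kernel status of the §6 interface predicate

PROOF-ONLY companion (abc-iut seat f-092, F fact-proving wave FLOAT, rung LADDER-ABC:A2.C) of abc-iut-L3-t2's
`TemperedAnabelian.lean` (p403906, FROZEN; imported, never edited or restated) for the FROZEN FACT-LIST row
**F-2551** `IsProfiniteCompletion ι` — S. Mochizuki, *Semi-graphs of anabelioids*, Publ. RIMS **42** (2006)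
[SemiAnbd] §6 p. 69 «we shall denote the profinite completion of a group by means of a "∧"», typed as a
`Prop`-valued STRUCTURE on a continuous homomorphism `ι : F → F̂` (compact, Hausdorff, totally disconnected
target; dense image; open normal finite-index subgroups of `F` are pull-backs of open normal subgroups of
`F̂`; pull-backs of open normal subgroups are open).  The row is a PARAMETRISED interface predicate (25
consumers take it as a hypothesis head; its one producer so far is abc-iut-c312-4's
`isProfiniteCompletion_id_GQp`).  This file records its kernel status AS TYPED:

1. `isProfiniteCompletion_id_iff` — for the identity `G → G` the predicate says EXACTLY «`G` is profinite»
   (compact ∧ Hausdorff ∧ totally disconnected; no `IsTopologicalGroup` hypothesis needed); the instance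
   direction is abc-iut's `isProfiniteCompletion_id` (`TemperedCurveHyperbolicWitness.lean`) /
   `isProfiniteCompletion_id_GQp` (`TemperedAnabelianWitness.lean`), not restated.
2. `isProfiniteCompletion_of_isInducing` — the STRUCTURAL instance: a continuous homomorphism with DENSE
   image into a profinite group, through which `F` carries the INDUCED topology, is a profinite completion in
   the typed sense (an open `U ⊴ F` is `ι⁻¹(W)`, `W ⊇ N` open normal in `F̂`, and then `V := N · ι(U)` works —
   the tree's `IsProfiniteCompletion.exists_openNormal_comap_eq`, `ProfiniteCompletionEta.lean`; no
   injectivity and no finite-index hypothesis are needed); corollary `isProfiniteCompletion_subgroup_of_dense`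
   for the inclusion of a dense subgroup — the reading «`Π^temp ↪ Π̂` with the induced topology».
3. `not_forall_isProfiniteCompletion` — the UNIVERSAL CLOSURE of the row is FALSE (the identity of the
   non-compact group `ℝ`, written multiplicatively, is not a profinite completion): the row is consumable at
   NAMED INSTANCES only (plan R5), as every interface predicate.

HONEST FRAMING: statements about OUR typed interface of a refereed prerequisite paper; the intended instance
(André's tempered fundamental group in its profinite completion) is not constructed in the tree; no bearing on,
and no side taken on, [IUTchIII] Cor 3.12; typed ≠ proved; a FACT-LIST row is an assumption label.
-/

noncomputable section

namespace Literature.AnabelianGeometry.SemiGraphs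

open _root_.Topology _root_.Set

universe u v

/-! ### 1. The identity: `IsProfiniteCompletion (id G)` ⟺ `G` is profinite -/

section Identity

variable {G : Type u} [Group G] [TopologicalSpace G]

/-- F-2551 at the identity (PROVED): `id : G → G` exhibits `G` as its own profinite completion in the typed
sense IFF `G` is compact, Hausdorff and totally disconnected — the subgroup clauses are automatic
([SemiAnbd] §6 p. 69, «profinite completion»). [cite: MochizukiSemiAnbd2006, §6 p.69] -/
theorem isProfiniteCompletion_id_iff :
    IsProfiniteCompletion (ContinuousMonoidHom.id G) ↔
      CompactSpace G ∧ T2Space G ∧ TotallyDisconnectedSpace G := by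
  constructor
  · intro h
    exact ⟨h.compactSpace, h.t2Space, h.totallyDisconnectedSpace⟩
  · rintro ⟨h₁, h₂, h₃⟩
    exact
      { compactSpace := h₁
        t2Space := h₂
        totallyDisconnectedSpace := h₃
        denseRange := denseRange_id
        comap_surjective := fun U _ => ⟨U, by ext; rfl⟩
        isOpen_comap := fun V => V.isOpen' }

end Identity

/-! ### 2. Dense image + induced topology into a profinite group -/

section Inducing

variable {F : Type u} {Fhat : Type v} [Group F] [TopologicalSpace F]
  [Group Fhat] [TopologicalSpace Fhat] [IsTopologicalGroup Fhat]
  [CompactSpace Fhat] [T2Space Fhat] [TotallyDisconnectedSpace Fhat]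

/-- **F-2551, STRUCTURAL INSTANCE (PROVED).**  A continuous homomorphism `ι : F → F̂` with DENSE image into a
profinite (compact, Hausdorff, totally disconnected) topological group, such that `F` carries the topology
INDUCED along `ι`, is a profinite completion in the typed sense of [SemiAnbd] §6 p. 69: an open normal
subgroup `U ⊆ F` is `ι⁻¹(W)` with `W` open; a profinite group has an open normal subgroup `N ⊆ W`
(Mathlib `ProfiniteGrp.exist_openNormalSubgroup_sub_open_nhds_of_one`), so `ι⁻¹(N) ≤ U`, and then
`V := N · ι(U)` is open normal with `ι⁻¹(V) = U` (the tree's `IsProfiniteCompletion.exists_openNormal_comap_eq`).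
Neither injectivity of `ι` nor the finite-index hypothesis of the field is used.
[cite: MochizukiSemiAnbd2006, §6 p.69] -/
theorem isProfiniteCompletion_of_isInducing (ι : F →ₜ* Fhat) (hι : IsInducing ι) (hd : DenseRange ι) :
    IsProfiniteCompletion ι where
  compactSpace := ‹_›
  t2Space := ‹_›
  totallyDisconnectedSpace := ‹_›
  denseRange := hd
  isOpen_comap V := V.isOpen'.preimage ι.continuous
  comap_surjective U _ := by
    -- `U = ι⁻¹(W)` with `W` open in `F̂`, `1 ∈ W`
    obtain ⟨W, hWopen, hWU⟩ := hι.isOpen_iff.mp U.isOpen'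
    have h1W : (1 : Fhat) ∈ W := by
      have : (1 : F) ∈ ι ⁻¹' W := by rw [hWU]; exact U.toSubgroup.one_mem
      simpa using this
    -- an open normal subgroup `N ⊆ W` of the profinite group `F̂`; then `ι⁻¹(N) ≤ U`
    obtain ⟨N, hNW⟩ := ProfiniteGrp.exist_openNormalSubgroup_sub_open_nhds_of_one hWopen h1W
    haveI : U.toSubgroup.Normal := U.isNormal'
    refine IsProfiniteCompletion.exists_openNormal_comap_eq ι hd N U.toSubgroup fun f hf => ?_
    have hf' : f ∈ ι ⁻¹' W := hNW hf
    rw [hWU] at hf'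
    exact hf'

end Inducing

/-- **F-2551 for dense subgroups (PROVED).**  The inclusion of a DENSE subgroup `H` of a profinite group `G`
(with the subspace topology) is a profinite completion in the typed sense — the reading «`Π^temp ↪ Π̂` with
the induced topology» of [SemiAnbd] §6 p. 69. [cite: MochizukiSemiAnbd2006, §6 p.69] -/
theorem isProfiniteCompletion_subgroup_of_dense {G : Type u} [Group G] [TopologicalSpace G]
    [IsTopologicalGroup G] [CompactSpace G] [T2Space G] [TotallyDisconnectedSpace G] (H : Subgroup G)
    (hH : Dense (H : Set G)) :
    IsProfiniteCompletion ({ H.subtype with continuous_toFun := continuous_subtype_val } : H →ₜ* G) :=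
  isProfiniteCompletion_of_isInducing _ IsInducing.subtypeVal (by
    have : range (({ H.subtype with continuous_toFun := continuous_subtype_val } : H →ₜ* G)) =
        (H : Set G) := by
      ext x; constructor
      · rintro ⟨y, rfl⟩; exact y.2
      · intro hx; exact ⟨⟨x, hx⟩, rfl⟩
    rw [DenseRange, this]
    exact hH)

/-! ### 3. The universal closure of the row is false -/

/-- F-2551 fails at degenerate data: the identity of the additive group `ℝ`, written multiplicatively (a
non-compact topological group), is NOT a profinite completion in the typed sense ([SemiAnbd] §6 p. 69; the
row is an interface predicate, consumable at named instances only). [cite: MochizukiSemiAnbd2006, §6 p.69] -/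
theorem not_isProfiniteCompletion_id_real :
    ¬ IsProfiniteCompletion (ContinuousMonoidHom.id (Multiplicative (ULift.{u} ℝ))) := by
  intro h
  have hc : CompactSpace (ULift.{u} ℝ) := h.compactSpace
  have hR : CompactSpace ℝ := Homeomorph.ulift.compactSpace
  exact not_compactSpace_iff.mpr (inferInstance : NoncompactSpace ℝ) hR

/-- **F-2551, UNIVERSAL CLOSURE REFUTED** (closed form, kernel): it is NOT the case that every continuous
homomorphism of topological groups is a profinite completion in the typed sense of [SemiAnbd] §6 p. 69 —
witness the identity of `ℝ`.  Instance forms: `isProfiniteCompletion_id`, `isProfiniteCompletion_of_isInducing`,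
`isProfiniteCompletion_subgroup_of_dense`, `isProfiniteCompletion_id_GQp`. [cite: MochizukiSemiAnbd2006, §6 p.69] -/
theorem not_forall_isProfiniteCompletion :
    ¬ ∀ (F Fhat : Type u) [Group F] [TopologicalSpace F] [Group Fhat] [TopologicalSpace Fhat]
      (ι : F →ₜ* Fhat), IsProfiniteCompletion ι :=
  fun h => not_isProfiniteCompletion_id_real.{u} (h _ _ (ContinuousMonoidHom.id _))

/-- F-2551 is satisfiable and refutable in the same universe: the row genuinely DEPENDS on its instance
(PROVED; [SemiAnbd] §6 p. 69). [cite: MochizukiSemiAnbd2006, §6 p.69] -/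
theorem isProfiniteCompletion_dependsOnInstance (p : ℕ) [Fact p.Prime] :
    IsProfiniteCompletion (ContinuousMonoidHom.id (GQp p)) ∧
      ¬ IsProfiniteCompletion (ContinuousMonoidHom.id (Multiplicative (ULift.{0} ℝ))) :=
  ⟨isProfiniteCompletion_id_GQp p, not_isProfiniteCompletion_id_real⟩

end Literature.AnabelianGeometry.SemiGraphs

end
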